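import Literature.NumberTheory.Automorphic.PlaneLatticesHermiteForm             -- ★ (L5-a): `IsUniformizingElement`, `𝒪[F]`, 2×2 algebra idiom
import Literature.NumberTheory.LocalFields.RamifiedQuadraticNormCriterion      -- ★ B-p10 (g26): `RamifiedQuadraticNorm.residue_map_eq` (σ is residually trivial)
import HarnessLib

/-!
# [LabesseLanglands1979 §2 pp. 8–9; Rogawski1990 §4.9] road «R1-ram» (tamely RAMIFIED place), brick R-3 FILE 4: the BIT of LEMMA U′ is a FORM VALUE —
# `e = 0 ⟺ −c·ϖ^{−i}·h((k − c)x, x)` has square residue, for ANY lattice vector `x` at which this test value is a unit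

Topic `NumberTheory/Automorphic`; namespace `Literature.NumberTheory.Automorphic`.  THEOREMS ONLY (no definition, no instance, no notation, no named fact, no `sorry`).
Cell `pub/hodgecm-mathlib` (D-0151), crux H413 = `stmt-HodgeConjecture-24833`, line «N6nsGerm», residue `RankOneUnstableTransferNonsplitCMERamified` of #159; LEAD F0P3a-plan (g10);
architect A-p16 (g27) RULING A-15 (b) ∕ A-17 (a) §4 (ii) («sign = B-p12 R-3»); numerical certificate B-p12 (g29) table 68cf7048 (READING (1): the bit is constant on spheres).
HONEST LABEL: HC_CM is proved only modulo the printed citations (the 2 remaining named inputs hLiu418, h413) until rung 0 closes; nothing printed is asserted here —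
this is `2×2` algebra over a valuation ring with involution.

MATHEMATICS.  Files 1–3 (★ `UnitaryRankTwoTorusLocalClassRamified`, `…Head`, `…Modular`) put a torus-regular `k ∈ U(J)(𝒪)` (`J = J₀ = [[0,1],[1,0]]` at an edge ∕ self-dual lattice,
`J = J♯ = [[0,−1],[1,0]]` at a vertex ∕ `ϖ`-modular lattice) into the normal form `κ⁻¹kκ = c(1 + ϖ^i[[0, η^e],[0,0]]) + ϖ^m R`, `κ ∈ U(J)(𝒪)`, with ONE BIT `e ∈ {0,1}`.
Here we READ the bit without conjugating: for the sesquilinear pairing `h(y, x) = Σ_r σ(y_r)(Jx)_r` and the TEST VALUE `T(x) := −c·ϖ^{−i}·h((k − c)x, x)`, `x ∈ 𝒪²`: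
writing `x = κx'` one has `h((k − c)x, x) = h((N_f − c)x', x')` (`κ` is `J`-unitary) and hence `T(x) = η^e·σ(x'₁)x'₁ + ϖ^{m−i}·G` with `G ∈ 𝒪` — so `T(x) ∈ 𝒪`, and
whenever `T(x)` is a unit its residue is `η̄^e·x̄'₁²` with `x̄'₁ ≠ 0`: a square iff `e = 0` (`σ` is residually trivial, `η̄` is a non-square); `x = κe₁` is such a vector.
Heads: **`normalForm_bit_readout`** (edge, `J₀`, odd `i`) and **`normalForm_bit_readout_modular`** (vertex, `J♯`, even `i`); they consume the CONCLUSIONS of files 1–3 as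
hypotheses, so a consumer chains `localClass_normalForm_ramified` (∃ κ e R …) with this file.  File 5 (`…RamifiedSign`) evaluates `T` on the torus eigenline and derives
the sign law per sphere (`e` depends on the lattice only through `(N + i)∕2`).

## References
* [LabesseLanglands1979] J.-P. Labesse, R. P. Langlands, *L-indistinguishability for SL(2)*, Canad. J. Math. 31 (1979): §2, Lemma 2.1, pp. 8–9 (ramified shells, the sign).
* [Rogawski1990] J. D. Rogawski, *Automorphic Representations of Unitary Groups in Three Variables*, Ann. of Math. Stud. 123 (1990): §4.9 Lemma 4.9.3 p. 56.
* [Jacobowitz1962] R. Jacobowitz, *Hermitian forms over local fields*, Amer. J. Math. 84 (1962): §4, §8. [Serre1979] J.-P. Serre, *Local Fields* (1979): Ch. V §3.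
-/

set_option autoImplicit false

noncomputable section

open scoped ValuativeRel Matrix MatrixGroups
open Matrix ValuativeRel

namespace Literature.NumberTheory.Automorphic

variable {F : Type*} [Field F] [ValuativeRel F]

section Bookkeeping
variable (σ : F →+* F)

omit [ValuativeRel F] in
/-- `(Mv)_r = M_{r0}v₀ + M_{r1}v₁`. [cite: Jacobowitz1962, §4] -/
private theorem mulVec_fin_two_apply (M : Matrix (Fin 2) (Fin 2) F) (v : Fin 2 → F) (r : Fin 2) : (M *ᵥ v) r = M r 0 * v 0 + M r 1 * v 1 := by
  show (fun j => M r j) ⬝ᵥ v = _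
  rw [Matrix.vec2_dotProduct]

omit [ValuativeRel F] in
/-- The pairing `h(y, z) = Σ_r σ(y_r)(Jz)_r` on `F²`, expanded. [cite: Jacobowitz1962, §4] -/
private theorem pairing_fin_two (J : Matrix (Fin 2) (Fin 2) F) (y z : Fin 2 → F) :
    (fun r => σ (y r)) ⬝ᵥ (J *ᵥ z) = σ (y 0) * (J 0 0 * z 0 + J 0 1 * z 1) + σ (y 1) * (J 1 0 * z 0 + J 1 1 * z 1) := by
  rw [Matrix.vec2_dotProduct, mulVec_fin_two_apply, mulVec_fin_two_apply]

omit [ValuativeRel F] in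
/-- Pairing invariance: for `κ` with `κᴴJκ = J`, `h(κy, κz) = h(y, z)` where `h(y, z) = Σ_r σ(y_r)(Jz)_r`. [cite: Jacobowitz1962, §4] -/
private theorem pairing_mulVec (J κ : Matrix (Fin 2) (Fin 2) F) (hκU : (κ.map σ)ᵀ * J * κ = J) (y z : Fin 2 → F) :
    (fun r => σ ((κ *ᵥ y) r)) ⬝ᵥ (J *ᵥ (κ *ᵥ z)) = (fun r => σ (y r)) ⬝ᵥ (J *ᵥ z) := by
  have h := fun r s => congr_fun (congr_fun hκU r) s
  have h00 := h 0 0; have h01 := h 0 1; have h10 := h 1 0; have h11 := h 1 1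
  simp only [Matrix.mul_apply, Matrix.transpose_apply, Matrix.map_apply, Fin.sum_univ_two] at h00 h01 h10 h11
  rw [pairing_fin_two, pairing_fin_two]
  simp only [mulVec_fin_two_apply, map_add, map_mul]
  linear_combination (σ (y 0) * z 0) * h00 + (σ (y 0) * z 1) * h01 + (σ (y 1) * z 0) * h10 + (σ (y 1) * z 1) * h11

omit [ValuativeRel F] in
/-- `J'J = 1`, `κᴴJκ = J` ⇒ `(J'κᴴJ)κ = 1`. [cite: Jacobowitz1962, §4] -/
private theorem inv_mul_of_unitary (J J' κ : Matrix (Fin 2) (Fin 2) F) (hJ'J : J' * J = 1) (hκU : (κ.map σ)ᵀ * J * κ = J) :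
    J' * (κ.map σ)ᵀ * J * κ = 1 := by
  rw [Matrix.mul_assoc, Matrix.mul_assoc, ← Matrix.mul_assoc _ J κ, hκU, hJ'J]

omit [ValuativeRel F] in
/-- In a field, `b ≠ 0` ⇒ (`a·b²` is a square iff `a` is). [cite: Serre1979, Ch. V §3] -/
private theorem isSquare_mul_sq_iff {K : Type*} [Field K] {a b : K} (hb : b ≠ 0) : IsSquare (a * b ^ 2) ↔ IsSquare a := by
  refine ⟨fun ⟨r, hr⟩ => ⟨r * b⁻¹, ?_⟩, fun ⟨r, hr⟩ => ⟨r * b, by rw [hr]; ring⟩⟩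
  have : a = a * b ^ 2 * (b⁻¹) ^ 2 := by field_simp
  rw [this, hr]; ring

/-- Entries of a product of two entrywise-integral `2×2` matrices are integral. [cite: Jacobowitz1962, §4] -/
private theorem mul_apply_mem {A B : Matrix (Fin 2) (Fin 2) F} (hA : ∀ r s, A r s ∈ 𝒪[F]) (hB : ∀ r s, B r s ∈ 𝒪[F]) (r s : Fin 2) :
    (A * B) r s ∈ 𝒪[F] := by
  rw [Matrix.mul_apply, Fin.sum_univ_two]
  exact (𝒪[F]).add_mem ((𝒪[F]).mul_mem (hA r 0) (hB 0 s)) ((𝒪[F]).mul_mem (hA r 1) (hB 1 s))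

/-- `|x| = 1 ⇒ x ∈ 𝒪`. [cite: Serre1979, Ch. V §2] -/
private theorem mem_of_valuation_eq_one {x : F} (hx : valuation F x = 1) : x ∈ 𝒪[F] :=
  (Valuation.mem_integer_iff _ _).2 hx.le

end Bookkeeping

section Core

variable (σ : F →+* F) {ϖ : F} (hϖ : IsUniformizingElement ϖ) (hσϖ : σ ϖ = -ϖ)
  (σO : 𝒪[F] →+* 𝒪[F]) (hσO : ∀ x : 𝒪[F], ((σO x : 𝒪[F]) : F) = σ x) (hσσ : ∀ x, σO (σO x) = x)

include hσO in
/-- `σ(𝒪) ⊆ 𝒪`. [cite: Serre1979, Ch. V §2] -/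
private theorem map_mem_integer {x : F} (hx : x ∈ 𝒪[F]) : σ x ∈ 𝒪[F] := by
  rw [← hσO ⟨x, hx⟩]; exact SetLike.coe_mem _

include hϖ hσϖ hσO in
/-- CORE EXPANSION of the test value.  `J, J' ∈ M₂(𝒪)`, `J'J = 1`, `J₀₀ = 0`, `−(−1)^i J₀₁ = 1`; `κ ∈ M₂(𝒪)` `J`-unitary, `R ∈ M₂(𝒪)`, `σc·c = 1`, `δ ∈ 𝒪` σ-fixed, and the
normal form `J'κᴴJ·k·κ = c(1 + ϖ^i[[0,δ],[0,0]]) + ϖ^{i+s+1}R`.  Then for `x ∈ 𝒪²`, with `x' := J'κᴴJ·x`:  `x'₁ ∈ 𝒪` and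
`−c·ϖ^{−i}·h((k−c)x, x) = δ·σ(x'₁)x'₁ + ϖ^{s+1}·G` for some `G ∈ 𝒪`. [cite: LabesseLanglands1979, §2 Lemma 2.1 pp. 8–9] [cite: Jacobowitz1962, §4] -/
private theorem testValue_expansion {J J' κ k R : Matrix (Fin 2) (Fin 2) F} (hJO : ∀ r s, J r s ∈ 𝒪[F]) (hJ'O : ∀ r s, J' r s ∈ 𝒪[F])
    (hJ'J : J' * J = 1) (hJ00 : J 0 0 = 0) {i s : ℕ} (hsgn : -(-1 : F) ^ i * J 0 1 = 1)
    (hκO : ∀ r s, κ r s ∈ 𝒪[F]) (hκU : (κ.map σ)ᵀ * J * κ = J) (hRO : ∀ r s, R r s ∈ 𝒪[F])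
    {c : F} (hc : σ c * c = 1) (hcO : c ∈ 𝒪[F]) {δ : F} (hσδ : σ δ = δ)
    (hnf : J' * (κ.map σ)ᵀ * J * k * κ = c • (1 + ϖ ^ i • !![0, δ; 0, 0]) + ϖ ^ (i + s + 1) • R)
    (x : Fin 2 → F) (hx : ∀ r, x r ∈ 𝒪[F]) :
    ((J' * (κ.map σ)ᵀ * J) *ᵥ x) 1 ∈ 𝒪[F] ∧ ∃ G ∈ 𝒪[F],
      -c * ϖ ^ (-(i : ℤ)) * ((fun r => σ (((k - c • 1) *ᵥ x) r)) ⬝ᵥ (J *ᵥ x)) =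
        δ * (σ (((J' * (κ.map σ)ᵀ * J) *ᵥ x) 1) * ((J' * (κ.map σ)ᵀ * J) *ᵥ x) 1) + ϖ ^ (s + 1) * G := by
  have hϖ0 : ϖ ≠ 0 := hϖ.ne_zero
  have hσmem : ∀ {x : F}, x ∈ 𝒪[F] → σ x ∈ 𝒪[F] := fun hx => map_mem_integer σ σO hσO hx
  obtain ⟨κ', hκ'⟩ : ∃ κ' : Matrix (Fin 2) (Fin 2) F, κ' = J' * (κ.map σ)ᵀ * J := ⟨_, rfl⟩
  rw [← hκ'] at hnf ⊢
  have h1 : κ' * κ = 1 := by rw [hκ']; exact inv_mul_of_unitary σ J J' κ hJ'J hκU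
  have h2 : κ * κ' = 1 := mul_eq_one_comm.1 h1
  have hκHO : ∀ r s, (κ.map σ)ᵀ r s ∈ 𝒪[F] := fun r s => by
    rw [Matrix.transpose_apply, Matrix.map_apply]; exact hσmem (hκO s r)
  have hκ'O : ∀ r s, κ' r s ∈ 𝒪[F] := by rw [hκ']; exact mul_apply_mem (mul_apply_mem hJ'O hκHO) hJO
  obtain ⟨x', hx'⟩ : ∃ x' : Fin 2 → F, x' = κ' *ᵥ x := ⟨_, rfl⟩
  rw [← hx']
  have hx'O : ∀ r, x' r ∈ 𝒪[F] := fun r => by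
    rw [hx', mulVec_fin_two_apply]
    exact (𝒪[F]).add_mem ((𝒪[F]).mul_mem (hκ'O r 0) (hx 0)) ((𝒪[F]).mul_mem (hκ'O r 1) (hx 1))
  have hxx : κ *ᵥ x' = x := by rw [hx', Matrix.mulVec_mulVec, h2, Matrix.one_mulVec]
  have hM : κ' * (k - c • (1 : Matrix (Fin 2) (Fin 2) F)) * κ = c • (1 + ϖ ^ i • !![0, δ; 0, 0]) + ϖ ^ (i + s + 1) • R - c • 1 := by
    rw [Matrix.mul_sub, Matrix.mul_smul, Matrix.mul_one, Matrix.sub_mul, Matrix.smul_mul, h1, hnf]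
  obtain ⟨w, hw⟩ : ∃ w : Fin 2 → F, w = κ' *ᵥ ((k - c • 1) *ᵥ x) := ⟨_, rfl⟩
  have hw' : w = (c • (1 + ϖ ^ i • !![0, δ; 0, 0]) + ϖ ^ (i + s + 1) • R - c • (1 : Matrix (Fin 2) (Fin 2) F)) *ᵥ x' := by
    rw [hw, ← hxx, Matrix.mulVec_mulVec, Matrix.mulVec_mulVec, hM]
  obtain ⟨G₀, hG₀⟩ : ∃ G₀ : F, G₀ = R 0 0 * x' 0 + R 0 1 * x' 1 := ⟨_, rfl⟩
  obtain ⟨G₁, hG₁⟩ : ∃ G₁ : F, G₁ = R 1 0 * x' 0 + R 1 1 * x' 1 := ⟨_, rfl⟩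
  have hG₀O : G₀ ∈ 𝒪[F] := by rw [hG₀]; exact (𝒪[F]).add_mem ((𝒪[F]).mul_mem (hRO 0 0) (hx'O 0)) ((𝒪[F]).mul_mem (hRO 0 1) (hx'O 1))
  have hG₁O : G₁ ∈ 𝒪[F] := by rw [hG₁]; exact (𝒪[F]).add_mem ((𝒪[F]).mul_mem (hRO 1 0) (hx'O 0)) ((𝒪[F]).mul_mem (hRO 1 1) (hx'O 1))
  have hw0 : w 0 = ϖ ^ i * ϖ ^ (s + 1) * G₀ + c * ϖ ^ i * δ * x' 1 := by
    rw [hw', hG₀, mulVec_fin_two_apply]; simp; ring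
  have hw1 : w 1 = ϖ ^ i * ϖ ^ (s + 1) * G₁ := by
    rw [hw', hG₁, mulVec_fin_two_apply]; simp; ring
  have hkx : (k - c • (1 : Matrix (Fin 2) (Fin 2) F)) *ᵥ x = κ *ᵥ w := by
    rw [hw, Matrix.mulVec_mulVec, h2, Matrix.one_mulVec]
  have hpair : (fun r => σ (((k - c • (1 : Matrix (Fin 2) (Fin 2) F)) *ᵥ x) r)) ⬝ᵥ (J *ᵥ x) = (fun r => σ (w r)) ⬝ᵥ (J *ᵥ x') := by
    rw [hkx, ← hxx]; exact pairing_mulVec σ J κ hκU w x'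
  set ϖ0 : F := ϖ ^ (-(i : ℤ)) with hϖ0def; clear_value ϖ0
  have hϖ0i : ϖ0 * ϖ ^ i = 1 := by rw [hϖ0def, ← zpow_natCast, ← zpow_add₀ hϖ0, neg_add_cancel, zpow_zero]
  refine ⟨hx'O 1, -c * (-1) ^ (i + s + 1) * (σ G₀ * (J 0 1 * x' 1) + σ G₁ * (J 1 0 * x' 0 + J 1 1 * x' 1)), ?_, ?_⟩
  · refine (𝒪[F]).mul_mem ((𝒪[F]).mul_mem ((𝒪[F]).neg_mem hcO) ((𝒪[F]).pow_mem ((𝒪[F]).neg_mem (𝒪[F]).one_mem) _)) ?_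
    exact (𝒪[F]).add_mem ((𝒪[F]).mul_mem (hσmem hG₀O) ((𝒪[F]).mul_mem (hJO 0 1) (hx'O 1)))
      ((𝒪[F]).mul_mem (hσmem hG₁O) ((𝒪[F]).add_mem ((𝒪[F]).mul_mem (hJO 1 0) (hx'O 0)) ((𝒪[F]).mul_mem (hJO 1 1) (hx'O 1))))
  · have hσpow : ∀ n : ℕ, σ (ϖ ^ n) = (-1) ^ n * ϖ ^ n := fun n => by rw [map_pow, hσϖ, neg_eq_neg_one_mul, mul_pow]
    rw [hpair, pairing_fin_two, hw0, hw1, hJ00]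
    simp only [map_add, map_mul, hσpow, hσδ]
    linear_combination (δ * (σ (x' 1) * x' 1)) * ((-(-1 : F) ^ i * J 0 1) * (σ c * c)) * hϖ0i
      + (δ * (σ (x' 1) * x' 1)) * (-(-1 : F) ^ i * J 0 1) * hc + (δ * (σ (x' 1) * x' 1)) * hsgn
      + (-c * (-1) ^ (i + s + 1) * (σ G₀ * (J 0 1 * x' 1) + σ G₁ * (J 1 0 * x' 0 + J 1 1 * x' 1)) * ϖ ^ (s + 1)) * hϖ0i

omit [ValuativeRel F] in
/-- The test vector `x = κe₁`: `(J'κᴴJ)(κ e₁) = e₁`, so `x'₁ = 1`. [cite: Jacobowitz1962, §4] -/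
private theorem testVector_coord {J J' κ : Matrix (Fin 2) (Fin 2) F} (hJ'J : J' * J = 1) (hκU : (κ.map σ)ᵀ * J * κ = J) :
    ((J' * (κ.map σ)ᵀ * J) *ᵥ (κ *ᵥ ![0, 1])) 1 = 1 := by
  rw [Matrix.mulVec_mulVec, inv_mul_of_unitary σ J J' κ hJ'J hκU, Matrix.one_mulVec]; simp

include hϖ hσO in
/-- RESIDUE STEP.  If `T ∈ 𝒪` has `T = η^e·σ(x₁)x₁ + ϖ^{s+1}G` (`x₁, G ∈ 𝒪`, `e ≤ 1`, `σ` residually trivial, `η̄` a non-square) and `T` is a unit, then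
`T̄ = η̄^e·x̄₁²` with `x̄₁ ≠ 0`, so `T̄` is a square iff `e = 0`. [cite: Serre1979, Ch. V §3] [cite: LabesseLanglands1979, §2 pp. 8–9] -/
private theorem isSquare_residue_iff (hres : ∀ x : 𝒪[F], σO x - x ∈ IsLocalRing.maximalIdeal 𝒪[F])
    {η : 𝒪[F]} (hη : ¬ IsSquare (IsLocalRing.residue 𝒪[F] η)) {e : ℕ} (he : e ≤ 1)
    {x₁ G : F} (hx₁ : x₁ ∈ 𝒪[F]) (hG : G ∈ 𝒪[F]) (s : ℕ) (T : 𝒪[F])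
    (hT : (T : F) = ((η : 𝒪[F]) : F) ^ e * (σ x₁ * x₁) + ϖ ^ (s + 1) * G) (hTu : IsUnit T) :
    IsSquare (IsLocalRing.residue 𝒪[F] T) ↔ e = 0 := by
  set X : 𝒪[F] := ⟨x₁, hx₁⟩ with hX
  set GO : 𝒪[F] := ⟨G, hG⟩ with hGO
  set ϖO : 𝒪[F] := ⟨ϖ, hϖ.mem⟩ with hϖO
  have hT' : T = η ^ e * (X * σO X) + ϖO ^ (s + 1) * GO := by
    apply Subtype.ext
    rw [hT]; push_cast; rw [hσO]; ring
  have hϖres : IsLocalRing.residue 𝒪[F] ϖO = 0 := by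
    rw [IsLocalRing.residue_eq_zero_iff, IsLocalRing.mem_maximalIdeal, mem_nonunits_iff,
      (Valuation.integer.integers (valuation F)).isUnit_iff_valuation_eq_one]
    exact hϖ.valuation_lt_one.ne
  have hTres : IsLocalRing.residue 𝒪[F] T = IsLocalRing.residue 𝒪[F] η ^ e * IsLocalRing.residue 𝒪[F] X ^ 2 := by
    rw [hT']
    simp only [map_add, map_mul, map_pow, hϖres, zero_pow (Nat.succ_ne_zero s), zero_mul, add_zero,
      LocalFields.RamifiedQuadraticNorm.residue_map_eq σO hres X]
    ring
  have hX0 : IsLocalRing.residue 𝒪[F] X ≠ 0 := by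
    intro h0
    have h1 := (IsLocalRing.residue_ne_zero_iff_isUnit T).2 hTu
    rw [hTres, h0, zero_pow two_ne_zero, mul_zero] at h1
    exact h1 rfl
  rw [hTres, isSquare_mul_sq_iff hX0]
  rcases Nat.le_one_iff_eq_zero_or_eq_one.1 he with rfl | rfl
  · simp
  · simp [hη]

include hϖ in
/-- VALUATION STEP.  `|η| = 1`, `G ∈ 𝒪` ⇒ `|η^e·(σ1·1) + ϖ^{s+1}G| = 1`. [cite: Serre1979, Ch. V §2] -/
private theorem valuation_testValue_one {η : 𝒪[F]} (hηu : IsUnit η) (e s : ℕ) {G : F} (hG : G ∈ 𝒪[F]) :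
    valuation F (((η : 𝒪[F]) : F) ^ e * (σ 1 * 1) + ϖ ^ (s + 1) * G) = 1 := by
  have hη1 : valuation F ((η : 𝒪[F]) : F) = 1 := (Valuation.integer.integers (valuation F)).isUnit_iff_valuation_eq_one.1 hηu
  have hηe : valuation F (((η : 𝒪[F]) : F) ^ e * (σ 1 * 1)) = 1 := by rw [map_one, mul_one, mul_one, map_pow, hη1, one_pow]
  have hlt : valuation F (ϖ ^ (s + 1) * G) < valuation F (((η : 𝒪[F]) : F) ^ e * (σ 1 * 1)) := by
    rw [hηe, map_mul, map_pow]
    calc valuation F ϖ ^ (s + 1) * valuation F G ≤ valuation F ϖ ^ (s + 1) * 1 :=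
          mul_le_mul_right ((Valuation.mem_integer_iff _ _).1 hG) _
      _ < 1 := by rw [mul_one]; exact pow_lt_one₀ zero_le hϖ.valuation_lt_one (Nat.succ_ne_zero s)
  rw [Valuation.map_add_eq_of_lt_left _ hlt, hηe]

include hϖ hσϖ hσO in
/-- **THE BIT IS A FORM VALUE (edge ∕ self-dual lattice, `J₀ = [[0,1],[1,0]]`, odd depth).**  Let `κ ∈ M₂(𝒪)` be `J₀`-unitary, `R ∈ M₂(𝒪)`, `σc·c = 1`, `|c| = 1`,
`i < m`, `i` odd, `e ≤ 1`, and `J₀κᴴJ₀·k·κ = c·(1 + ϖ^i·[[0, η^e],[0,0]]) + ϖ^m·R` (the conclusion of ★ `exists_unitary_conj_eq_normalForm_of_eigenvector_ramified` ∕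
★ `localClass_normalForm_ramified`); `σϖ = −ϖ`, `σ` residually trivial, `η` a σ-fixed unit with non-square residue.  With the TEST VALUE
`T(x) := −c·ϖ^{−i}·Σ_r σ(((k − c)x)_r)·(J₀x)_r` (= `−c·ϖ^{−i}·h((k−c)x, x)`):  for every `x ∈ 𝒪²`, `T(x) ∈ 𝒪`, and if `T(x)` is a unit then
(`T(x)` has square residue iff `e = 0`); and some `x ∈ 𝒪²` has `|T(x)| = 1`.  So the bit is basis-free and readable from any generic lattice vector.
[cite: LabesseLanglands1979, §2 Lemma 2.1 pp. 8–9] [cite: Rogawski1990, §4.9 Lemma 4.9.3 p. 56] [cite: Jacobowitz1962, §8] [cite: Serre1979, Ch. V §3] -/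
theorem normalForm_bit_readout
    (hres : ∀ x : 𝒪[F], σO x - x ∈ IsLocalRing.maximalIdeal 𝒪[F])
    {η : 𝒪[F]} (hηu : IsUnit η) (hση : σO η = η) (hη : ¬ IsSquare (IsLocalRing.residue 𝒪[F] η))
    {k κ R : Matrix (Fin 2) (Fin 2) F} (hκO : ∀ r s, κ r s ∈ 𝒪[F]) (hκU : (κ.map σ)ᵀ * !![0, 1; 1, 0] * κ = !![0, 1; 1, 0])
    (hRO : ∀ r s, R r s ∈ 𝒪[F]) {c : F} (hc : σ c * c = 1) (hc1 : valuation F c = 1)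
    {i m : ℕ} (him : i < m) (hi : Odd i) {e : ℕ} (he : e ≤ 1)
    (hnf : !![0, 1; 1, 0] * (κ.map σ)ᵀ * !![0, 1; 1, 0] * k * κ = c • (1 + ϖ ^ i • !![0, ((η : 𝒪[F]) : F) ^ e; 0, 0]) + ϖ ^ m • R) :
    (∀ x : Fin 2 → F, (∀ r, x r ∈ 𝒪[F]) →
      -c * ϖ ^ (-(i : ℤ)) * ((fun r => σ (((k - c • 1) *ᵥ x) r)) ⬝ᵥ (!![0, 1; 1, 0] *ᵥ x)) ∈ 𝒪[F] ∧
      ∀ T : 𝒪[F], (T : F) = -c * ϖ ^ (-(i : ℤ)) * ((fun r => σ (((k - c • 1) *ᵥ x) r)) ⬝ᵥ (!![0, 1; 1, 0] *ᵥ x)) →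
        IsUnit T → (IsSquare (IsLocalRing.residue 𝒪[F] T) ↔ e = 0)) ∧
    ∃ x : Fin 2 → F, (∀ r, x r ∈ 𝒪[F]) ∧
      valuation F (-c * ϖ ^ (-(i : ℤ)) * ((fun r => σ (((k - c • 1) *ᵥ x) r)) ⬝ᵥ (!![0, 1; 1, 0] *ᵥ x))) = 1 := by
  obtain ⟨s, rfl⟩ := Nat.exists_eq_add_of_lt him
  have hJO : ∀ r s, (!![0, 1; 1, 0] : Matrix (Fin 2) (Fin 2) F) r s ∈ 𝒪[F] :=
    Fin.forall_fin_two.2 ⟨Fin.forall_fin_two.2 ⟨by simp, by simp⟩, Fin.forall_fin_two.2 ⟨by simp, by simp⟩⟩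
  have hJJ : (!![0, 1; 1, 0] : Matrix (Fin 2) (Fin 2) F) * !![0, 1; 1, 0] = 1 := by
    rw [Matrix.mul_fin_two, Matrix.one_fin_two]; norm_num
  have hsgn : -(-1 : F) ^ i * (!![0, 1; 1, 0] : Matrix (Fin 2) (Fin 2) F) 0 1 = 1 := by simp [hi.neg_one_pow]
  have hσδ : σ (((η : 𝒪[F]) : F) ^ e) = ((η : 𝒪[F]) : F) ^ e := by rw [map_pow, ← hσO, hση]
  have hcO : c ∈ 𝒪[F] := mem_of_valuation_eq_one hc1
  have core := fun x hx => testValue_expansion σ hϖ hσϖ σO hσO hJO hJO hJJ (by simp) hsgn hκO hκU hRO hc hcO hσδ hnf x hx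
  refine ⟨fun x hx => ?_, ⟨κ *ᵥ ![0, 1], ?_, ?_⟩⟩
  · obtain ⟨hx1, G, hG, hT⟩ := core x hx
    refine ⟨?_, fun T hTT hTu => ?_⟩
    · rw [hT]
      exact (𝒪[F]).add_mem ((𝒪[F]).mul_mem ((𝒪[F]).pow_mem η.2 e) ((𝒪[F]).mul_mem (map_mem_integer σ σO hσO hx1) hx1))
        ((𝒪[F]).mul_mem ((𝒪[F]).pow_mem hϖ.mem _) hG)
    · rw [hT] at hTT
      exact isSquare_residue_iff σ hϖ σO hσO hres hη he hx1 hG s T hTT hTu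
  · intro r; rw [mulVec_fin_two_apply]; simpa using hκO r 1
  · obtain ⟨-, G, hG, hT⟩ := core (κ *ᵥ ![0, 1]) (fun r => by rw [mulVec_fin_two_apply]; simpa using hκO r 1)
    rw [hT, testVector_coord σ hJJ hκU]
    exact valuation_testValue_one σ hϖ hηu e s hG

include hϖ hσϖ hσO in
/-- **THE BIT IS A FORM VALUE (vertex ∕ `ϖ`-modular lattice, `J♯ = [[0,−1],[1,0]]`, even depth).**  As `normalForm_bit_readout`, for `κ` `J♯`-unitary and the
normal form `[[0,1],[−1,0]]κᴴJ♯·k·κ = c·(1 + ϖ^i·[[0, η^e],[0,0]]) + ϖ^m·R` of ★ `exists_unitary_conj_eq_normalForm_of_eigenvector_ramified_modular` (`i` even), with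
the test value `T♯(x) := −c·ϖ^{−i}·Σ_r σ(((k − c)x)_r)·(J♯x)_r`. [cite: LabesseLanglands1979, §2 Lemma 2.1 pp. 8–9] [cite: Rogawski1990, §4.9 Lemma 4.9.3 p. 56]
[cite: Jacobowitz1962, §8] [cite: Serre1979, Ch. V §3] -/
theorem normalForm_bit_readout_modular
    (hres : ∀ x : 𝒪[F], σO x - x ∈ IsLocalRing.maximalIdeal 𝒪[F])
    {η : 𝒪[F]} (hηu : IsUnit η) (hση : σO η = η) (hη : ¬ IsSquare (IsLocalRing.residue 𝒪[F] η))
    {k κ R : Matrix (Fin 2) (Fin 2) F} (hκO : ∀ r s, κ r s ∈ 𝒪[F]) (hκU : (κ.map σ)ᵀ * !![0, -1; 1, 0] * κ = !![0, -1; 1, 0])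
    (hRO : ∀ r s, R r s ∈ 𝒪[F]) {c : F} (hc : σ c * c = 1) (hc1 : valuation F c = 1)
    {i m : ℕ} (him : i < m) (hi : Even i) {e : ℕ} (he : e ≤ 1)
    (hnf : !![0, 1; -1, 0] * (κ.map σ)ᵀ * !![0, -1; 1, 0] * k * κ = c • (1 + ϖ ^ i • !![0, ((η : 𝒪[F]) : F) ^ e; 0, 0]) + ϖ ^ m • R) :
    (∀ x : Fin 2 → F, (∀ r, x r ∈ 𝒪[F]) →
      -c * ϖ ^ (-(i : ℤ)) * ((fun r => σ (((k - c • 1) *ᵥ x) r)) ⬝ᵥ (!![0, -1; 1, 0] *ᵥ x)) ∈ 𝒪[F] ∧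
      ∀ T : 𝒪[F], (T : F) = -c * ϖ ^ (-(i : ℤ)) * ((fun r => σ (((k - c • 1) *ᵥ x) r)) ⬝ᵥ (!![0, -1; 1, 0] *ᵥ x)) →
        IsUnit T → (IsSquare (IsLocalRing.residue 𝒪[F] T) ↔ e = 0)) ∧
    ∃ x : Fin 2 → F, (∀ r, x r ∈ 𝒪[F]) ∧
      valuation F (-c * ϖ ^ (-(i : ℤ)) * ((fun r => σ (((k - c • 1) *ᵥ x) r)) ⬝ᵥ (!![0, -1; 1, 0] *ᵥ x))) = 1 := by
  obtain ⟨s, rfl⟩ := Nat.exists_eq_add_of_lt him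
  have hJO : ∀ r s, (!![0, -1; 1, 0] : Matrix (Fin 2) (Fin 2) F) r s ∈ 𝒪[F] :=
    Fin.forall_fin_two.2 ⟨Fin.forall_fin_two.2 ⟨by simp, by simp⟩, Fin.forall_fin_two.2 ⟨by simp, by simp⟩⟩
  have hJ'O : ∀ r s, (!![0, 1; -1, 0] : Matrix (Fin 2) (Fin 2) F) r s ∈ 𝒪[F] :=
    Fin.forall_fin_two.2 ⟨Fin.forall_fin_two.2 ⟨by simp, by simp⟩, Fin.forall_fin_two.2 ⟨by simp, by simp⟩⟩
  have hJJ : (!![0, 1; -1, 0] : Matrix (Fin 2) (Fin 2) F) * !![0, -1; 1, 0] = 1 := by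
    rw [Matrix.mul_fin_two, Matrix.one_fin_two]; norm_num
  have hsgn : -(-1 : F) ^ i * (!![0, -1; 1, 0] : Matrix (Fin 2) (Fin 2) F) 0 1 = 1 := by simp [hi.neg_one_pow]
  have hσδ : σ (((η : 𝒪[F]) : F) ^ e) = ((η : 𝒪[F]) : F) ^ e := by rw [map_pow, ← hσO, hση]
  have hcO : c ∈ 𝒪[F] := mem_of_valuation_eq_one hc1
  have core := fun x hx => testValue_expansion σ hϖ hσϖ σO hσO hJO hJ'O hJJ (by simp) hsgn hκO hκU hRO hc hcO hσδ hnf x hx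
  refine ⟨fun x hx => ?_, ⟨κ *ᵥ ![0, 1], ?_, ?_⟩⟩
  · obtain ⟨hx1, G, hG, hT⟩ := core x hx
    refine ⟨?_, fun T hTT hTu => ?_⟩
    · rw [hT]
      exact (𝒪[F]).add_mem ((𝒪[F]).mul_mem ((𝒪[F]).pow_mem η.2 e) ((𝒪[F]).mul_mem (map_mem_integer σ σO hσO hx1) hx1))
        ((𝒪[F]).mul_mem ((𝒪[F]).pow_mem hϖ.mem _) hG)
    · rw [hT] at hTT
      exact isSquare_residue_iff σ hϖ σO hσO hres hη he hx1 hG s T hTT hTu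
  · intro r; rw [mulVec_fin_two_apply]; simpa using hκO r 1
  · obtain ⟨-, G, hG, hT⟩ := core (κ *ᵥ ![0, 1]) (fun r => by rw [mulVec_fin_two_apply]; simpa using hκO r 1)
    rw [hT, testVector_coord σ hJJ hκU]
    exact valuation_testValue_one σ hϖ hηu e s hG

end Core

end Literature.NumberTheory.Automorphic

end
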